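import Mathlib
import Literature.Analysis.FluidPDE.BoundedLerayHopfClay
import Literature.Analysis.FluidPDE.LeraySuitableWeakSolutions
import Literature.Analysis.FluidPDE.NSCriticalClosureBesovKatoClass
import Literature.Analysis.FluidPDE.NSBoundedHigherRegularityQuantProofs
import Literature.Analysis.FluidPDE.SuitableWeakRescaling
import Literature.Analysis.FluidPDE.SpaceTimeRescaling
import Literature.Analysis.FluidPDE.NSBootstrapContinuousRep
import Literature.Analysis.FluidPDE.NSLerayHopfSereginMild
import Literature.Analysis.FluidPDE.LocalTypeI
import Literature.Analysis.Calculus.DifferenceQuotientHolder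
import HarnessLib

/-!
# Route RootDecompLitSlice — brick B1 of the aside D₁ `DarkBallSpreads` (stmt-NavierStokesRegularity-29566):
# REGULAR-POINT SMOOTHING UP TO THE TERMINAL TIME, part 1 — the Hölder representative

For `ν > 0`, `T > 0` and a classical solution `(u, p)` of the unforced Navier–Stokes system on `[0, T) × ℝ³`
that is Leray–Hopf on `[0, T]` from the rapidly decaying datum `u 0` (the class of D₁ / D), let `x₀` be a point
below which `u` is bounded on some backward cylinder, i.e. `(T, x₀)` is NOT a backward singular point
(`¬ IsBackwardSingularPoint u (T, x₀)`). Then on a smaller backward cylinder `Q_r(T, x₀) = (T − r², T) × B_r(x₀)`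
EVERY spatial derivative `(t, x) ↦ Dⁿₓ u(t, x)` is BOUNDED and HÖLDER CONTINUOUS in space–time (sup metric),
uniformly up to the top time `T` (`regularPoint_iteratedFDeriv_bounds`, in the companion file
`RootDecompLitSliceDarkBallSpreadsRegularPointSmoothing.lean`). THIS FILE (part 1) builds the viscosity-normalised
bounded distributional solution on a standard cylinder (`exists_unit_distributional_on_cylinder`) and the Hölder
representative of Seregin–Šverák identified with the rescaled classical solution (`exists_holder_representative`).

Proof (assembly over tree theorems, no new mathematics):
* the CKN-suitable global Leray–Hopf solution `(v, q)` from `u 0` (`exists_isGlobalLerayHopf_and_isLocalEnergySolutionOn`,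
  global `L^{3/2}` pressure) agrees with `u` a.e. on `(0,T) × ℝ³` (`isKatoSolutionOn_of_classical` +
  `IsGlobalLerayHopf.ae_eq_uncurry_of_isKatoSolutionOn_of_decay`), so it is essentially bounded on `Q_R(T, x₀)`;
* restrict to the cylinder (`IsSuitableWeakSolutionOn.mono_holds`) and normalise the viscosity by the time
  rescaling `Φ(s, y) = (T + s/ν, x₀ + y)` (`IsSuitableWeakSolutionOn.stRescale` with `α = β = ν⁻¹`, `γ = 1`): a
  unit-viscosity suitable weak solution on `Q_ρ(0, 0)`, `ρ = min(R, R√ν)`, bounded by `M/ν`, pressure in `L^{3/2}`;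
* the PROVED quantitative interior regularity of bounded distributional solutions
  `NSBoundedHigherRegularityBounds_holds` (Seregin–Šverák 2009 §2; Seregin 2014 §6.3) gives a representative with
  all spatial derivatives bounded and space–time Hölder on `Q_{ρ'}(0,0)`, `ρ' < ρ`;
* that representative coincides with the (continuous) rescaled classical solution on the open cylinder
  (`eqOn_of_ae_eq_of_continuousOn`), and the bounds are transported back to `u` along `Φ`
  (`Filter.EventuallyEq.iteratedFDeriv`, `iteratedFDeriv_comp_sub`, `iteratedFDeriv_const_smul_apply`,
  `Literature.Analysis.Calculus.holderOnWith_const_smul`).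

HONEST FRAMING: bookkeeping about a HYPOTHETICAL singular time; closes no item (D₁ still needs the flatness ⟹
infinite-order step, the ESS unique continuation application, the propagation over the connected regular slice
and the assembly with the landed B0/B5/B6′/B6″ and the writer's B2); nothing here bears on NS regularity (rung 0).
Lands `--supports stmt-NavierStokesRegularity-29566` (census instrument decomp-ns-census-1 g28).
-/

noncomputable section

open MeasureTheory Set Function Filter Topology Metric TopologicalSpace
open scoped ENNReal NNReal ContDiff
open Literature.Analysis Literature.Analysis.FluidPDE

-- the summit and its single sub-problem share the name (CONVENTIONS §1), as in every Theorems file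
set_option linter.dupNamespace false

namespace Summit.NavierStokesRegularity.NavierStokesRegularity.Theorems

/-! ### Step 1 — a unit-viscosity bounded suitable weak solution on a standard cylinder, a.e. equal to the
rescaled classical solution -/

/-- **The rescaled continuation.** Under the hypotheses of D₁ minus maximality, at a point `x₀` with `(T, x₀)` not
backward singular there are `R > 0` with `R² < T`, a bound `M`, a radius `ρ > 0` and a pair `(W, Π)` such that, with
`Φ(s, y) = (T + s/ν, x₀ + y)`: `(W, Π)` is a distributional Navier–Stokes solution with unit viscosity on
`Q_ρ(0,0)`, `‖W‖ ≤ M` a.e. there, `∫∫_{Q_ρ} ‖Π‖^{3/2} < ∞`, `Φ(Q_ρ(0,0)) ⊆ Q_R(T, x₀) ⊆ (0,T) × ℝ³`, and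
`W = ν⁻¹ • (u ∘ Φ)` a.e. on `Q_ρ(0,0)`. [this file] -/
theorem exists_unit_distributional_on_cylinder {ν T : ℝ} (hν : 0 < ν) (hT : 0 < T)
    {u : ℝ → EuclideanSpace ℝ (Fin 3) → EuclideanSpace ℝ (Fin 3)} {p : ℝ → EuclideanSpace ℝ (Fin 3) → ℝ}
    (hsol : IsClassicalNSSolutionOn (Ico 0 T) ν 0 u p) (hLH : IsLerayHopfOn T ν 0 (u 0) u)
    (hdec : HasRapidSpatialDecay (u 0)) {x₀ : EuclideanSpace ℝ (Fin 3)}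
    (hx₀ : ¬ IsBackwardSingularPoint u ((T : ℝ), x₀)) :
    ∃ (ρ M : ℝ) (W : ℝ → EuclideanSpace ℝ (Fin 3) → EuclideanSpace ℝ (Fin 3))
      (P : ℝ → EuclideanSpace ℝ (Fin 3) → ℝ),
      0 < ρ ∧ ρ ^ 2 / ν < T ∧
      IsDistributionalNSSolutionOn
        (parabolicCylinderOpens ρ ((0 : ℝ), (0 : EuclideanSpace ℝ (Fin 3)))) 1 0 W P ∧
      (∀ᵐ w ∂(volume.restrict (parabolicCylinder ρ ((0 : ℝ), (0 : EuclideanSpace ℝ (Fin 3))))),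
        ‖W w.1 w.2‖ ≤ M) ∧
      (∫⁻ w in parabolicCylinder ρ ((0 : ℝ), (0 : EuclideanSpace ℝ (Fin 3))),
        ‖P w.1 w.2‖ₑ ^ (3 / 2 : ℝ) < ⊤) ∧
      uncurry W =ᵐ[volume.restrict (parabolicCylinder ρ ((0 : ℝ), (0 : EuclideanSpace ℝ (Fin 3))))]
        uncurry (ν⁻¹ • stPull ν⁻¹ 1 T x₀ u) := by
  -- a backward cylinder on which `u` is essentially bounded, with `R² < T`
  obtain ⟨R₀, hR₀, hfin₀⟩ : ∃ R₀ : ℝ, 0 < R₀ ∧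
      eLpNorm (uncurry u) ⊤ (volume.restrict (parabolicCylinder R₀ ((T : ℝ), x₀))) < ⊤ := by
    simp only [IsBackwardSingularPoint, not_forall] at hx₀
    obtain ⟨r, hr, hne⟩ := hx₀
    exact ⟨r, hr, lt_top_iff_ne_top.2 hne⟩
  set R : ℝ := min R₀ (Real.sqrt T / 2) with hR_def
  have hsqT : 0 < Real.sqrt T := Real.sqrt_pos.2 hT
  have hR : 0 < R := lt_min hR₀ (by positivity)
  have hRR₀ : R ≤ R₀ := min_le_left _ _
  have hRT : R ^ 2 < T := by
    have h1 : R ≤ Real.sqrt T / 2 := min_le_right _ _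
    have h2 : R ^ 2 ≤ (Real.sqrt T / 2) ^ 2 := pow_le_pow_left₀ hR.le h1 2
    have h3 : (Real.sqrt T / 2) ^ 2 = T / 4 := by
      rw [div_pow, Real.sq_sqrt hT.le]; norm_num
    linarith
  have hfin : eLpNorm (uncurry u) ⊤ (volume.restrict (parabolicCylinder R ((T : ℝ), x₀))) < ⊤ :=
    lt_of_le_of_lt (eLpNorm_mono_measure _
      (Measure.restrict_mono (parabolicCylinder_subset_of_le hR.le hRR₀ _) le_rfl)) hfin₀
  -- the essential bound `M`
  set M : ℝ := (eLpNorm (uncurry u) ⊤ (volume.restrict (parabolicCylinder R ((T : ℝ), x₀)))).toReal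
    with hM_def
  have hbd_u : ∀ᵐ w ∂(volume.restrict (parabolicCylinder R ((T : ℝ), x₀))), ‖uncurry u w‖ ≤ M := by
    filter_upwards [ae_le_eLpNormEssSup (μ := volume.restrict (parabolicCylinder R ((T : ℝ), x₀)))
      (f := uncurry u)] with w hw
    rw [← eLpNorm_exponent_top] at hw
    have := ENNReal.toReal_mono hfin.ne hw
    rwa [toReal_enorm] at this
  -- the CKN-suitable global Leray–Hopf continuation from `u 0`, a.e. equal to `u` below `T`
  have h0 : (0 : ℝ) ∈ Ico 0 T := ⟨le_rfl, hT⟩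
  have hu₀ : ContDiff ℝ ∞ (u 0) := hsol.contDiff_velocity h0
  have hdiv : VectorCalculus.IsDivFree (u 0) := hsol.divFree 0 h0
  have hwdiv : IsWeaklyDivFree (u 0) := hLH.isWeaklyDivFree_datum hT
  have hu02 : MemLp (u 0) 2 volume := hLH.memLp 0 ⟨le_rfl, hT.le⟩
  have hK : IsKatoSolutionOn T ν (u 0) u := isKatoSolutionOn_of_classical hν hT hsol hLH hdec
  obtain ⟨v, q, hG, -, -, -, hq32, -, hLE⟩ := exists_isGlobalLerayHopf_and_isLocalEnergySolutionOn hν hu02 hwdiv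
  have hae : uncurry v =ᵐ[volume.restrict (Ioo 0 T ×ˢ (univ : Set (EuclideanSpace ℝ (Fin 3))))] uncurry u :=
    hG.ae_eq_uncurry_of_isKatoSolutionOn_of_decay hν hu₀ hdiv hdec hT hK
  -- `Q_R(T, x₀) ⊆ (0, T) × ℝ³`
  have hQsub : parabolicCylinder R ((T : ℝ), x₀) ⊆ Ioo 0 T ×ˢ (univ : Set (EuclideanSpace ℝ (Fin 3))) := by
    rintro ⟨t, y⟩ hw
    rw [mem_parabolicCylinder] at hw
    exact ⟨⟨by simp only at hw; linarith [hw.1.1], by simpa using hw.1.2⟩, mem_univ _⟩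
  have hbd_v : ∀ᵐ w ∂(volume.restrict (parabolicCylinder R ((T : ℝ), x₀))), ‖uncurry v w‖ ≤ M := by
    filter_upwards [hbd_u, ae_restrict_of_ae_restrict_of_subset hQsub hae] with w h1 h2
    rw [h2]; exact h1
  -- suitability on the cylinder, then unit-viscosity normalisation along `Φ(s, y) = (T + s/ν, x₀ + y)`
  have hT1 : 0 < T + 1 := by linarith
  have hle : parabolicCylinderOpens R ((T : ℝ), x₀) ≤
      slab (EuclideanSpace ℝ (Fin 3)) (Ioo 0 (T + 1)) isOpen_Ioo := by
    intro w hw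
    change w ∈ parabolicCylinder R ((T : ℝ), x₀) at hw
    change w ∈ Ioo 0 (T + 1) ×ˢ (univ : Set (EuclideanSpace ℝ (Fin 3)))
    obtain ⟨⟨h1, h2⟩, -⟩ := hQsub hw
    exact ⟨⟨h1, by linarith⟩, mem_univ _⟩
  have hsuitR : IsSuitableWeakSolutionOn (parabolicCylinderOpens R ((T : ℝ), x₀)) ν 0 v q :=
    IsSuitableWeakSolutionOn.mono_holds (hLE (T + 1) hT1).suitable hle
  have hνi : 0 < ν⁻¹ := inv_pos.2 hν
  have hW := hsuitR.stRescale hνi one_pos (show ν⁻¹ = ν⁻¹ * 1 by ring) T x₀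
  have hvis : ν⁻¹ * ν / 1 = 1 := by field_simp
  have hf0 : ((ν⁻¹) ^ 2 * 1) • stPull ν⁻¹ 1 T x₀ (0 : ℝ → EuclideanSpace ℝ (Fin 3) → EuclideanSpace ℝ (Fin 3)) = 0 := by
    funext s y; simp [stPull_apply]
  rw [hvis, hf0] at hW
  -- the standard cylinder `Q_ρ(0,0)` inside `Φ⁻¹(Q_R(T, x₀))`
  set ρ : ℝ := min R (Real.sqrt ν * R) with hρ_def
  have hsν : 0 < Real.sqrt ν := Real.sqrt_pos.2 hν
  have hρ : 0 < ρ := lt_min hR (by positivity)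
  have hρR : ρ ≤ R := min_le_left _ _
  have hρν : ρ ^ 2 ≤ ν * R ^ 2 := by
    have h1 : ρ ≤ Real.sqrt ν * R := min_le_right _ _
    have h2 : ρ ^ 2 ≤ (Real.sqrt ν * R) ^ 2 := pow_le_pow_left₀ hρ.le h1 2
    rwa [mul_pow, Real.sq_sqrt hν.le] at h2
  have hρT : ρ ^ 2 / ν < T := by
    rw [div_lt_iff₀ hν]; nlinarith
  have hsubρ : parabolicCylinder ρ ((0 : ℝ), (0 : EuclideanSpace ℝ (Fin 3))) ⊆
      stAffine ν⁻¹ 1 T x₀ ⁻¹' parabolicCylinder R ((T : ℝ), x₀) := by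
    rintro ⟨s, y⟩ hw
    rw [mem_parabolicCylinder] at hw
    simp only at hw
    rw [mem_preimage, stAffine_apply, mem_parabolicCylinder]
    simp only [one_smul]
    refine ⟨⟨?_, ?_⟩, ?_⟩
    · have : -(ν * R ^ 2) < s := by linarith [hw.1.1]
      have h' : ν⁻¹ * s > ν⁻¹ * (-(ν * R ^ 2)) := mul_lt_mul_of_pos_left this hνi
      have h'' : ν⁻¹ * (-(ν * R ^ 2)) = -R ^ 2 := by field_simp
      linarith
    · have : ν⁻¹ * s < 0 := mul_neg_of_pos_of_neg hνi hw.1.2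
      linarith
    · rw [dist_eq_norm, add_sub_cancel_left]
      have : dist y 0 < ρ := hw.2
      rw [dist_zero_right] at this
      linarith
  have hle2 : parabolicCylinderOpens ρ ((0 : ℝ), (0 : EuclideanSpace ℝ (Fin 3))) ≤
      stPreimage ν⁻¹ 1 T x₀ (parabolicCylinderOpens R ((T : ℝ), x₀)) := fun w hw => hsubρ hw
  have hWρ := IsSuitableWeakSolutionOn.mono_holds hW hle2
  refine ⟨ρ, ν⁻¹ * M, ν⁻¹ • stPull ν⁻¹ 1 T x₀ v, (ν⁻¹) ^ 2 • stPull ν⁻¹ 1 T x₀ q, hρ, hρT,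
    hWρ.distributional, ?_, ?_, ?_⟩
  · -- the essential bound transported along `Φ`
    have h1 := ae_restrict_preimage_stAffine hνi one_pos T x₀ hbd_v
    filter_upwards [ae_restrict_of_ae_restrict_of_subset hsubρ h1] with w hw
    have e : (ν⁻¹ • stPull ν⁻¹ 1 T x₀ v) w.1 w.2 = ν⁻¹ • uncurry v (stAffine ν⁻¹ 1 T x₀ w) := by
      simp only [Pi.smul_apply, stPull_apply]; rfl
    rw [e, norm_smul, Real.norm_eq_abs, abs_of_pos hνi]
    exact mul_le_mul_of_nonneg_left hw hνi.le
  · -- the pressure is in `L^{3/2}` of the cylinder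
    have hc : ∀ w : ℝ × EuclideanSpace ℝ (Fin 3),
        ‖((ν⁻¹) ^ 2 • stPull ν⁻¹ 1 T x₀ q) w.1 w.2‖ₑ ^ (3 / 2 : ℝ) =
          ‖(ν⁻¹) ^ 2‖ₑ ^ (3 / 2 : ℝ) * ‖uncurry q (stAffine ν⁻¹ 1 T x₀ w)‖ₑ ^ (3 / 2 : ℝ) := by
      intro w
      change ‖(ν⁻¹) ^ 2 • q (T + ν⁻¹ * w.1) (x₀ + (1 : ℝ) • w.2)‖ₑ ^ (3 / 2 : ℝ) = _
      rw [enorm_smul, ENNReal.mul_rpow_of_nonneg _ _ (by norm_num : (0 : ℝ) ≤ 3 / 2)]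
      rfl
    simp_rw [hc]
    rw [lintegral_const_mul' _ _ (ENNReal.rpow_ne_top_of_nonneg (by norm_num) enorm_ne_top)]
    refine ENNReal.mul_lt_top (ENNReal.rpow_lt_top_of_nonneg (by norm_num) enorm_ne_top) ?_
    calc ∫⁻ w in parabolicCylinder ρ ((0 : ℝ), (0 : EuclideanSpace ℝ (Fin 3))),
          ‖uncurry q (stAffine ν⁻¹ 1 T x₀ w)‖ₑ ^ (3 / 2 : ℝ)
        ≤ ∫⁻ w in stAffine ν⁻¹ 1 T x₀ ⁻¹' parabolicCylinder R ((T : ℝ), x₀),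
            ‖uncurry q (stAffine ν⁻¹ 1 T x₀ w)‖ₑ ^ (3 / 2 : ℝ) := lintegral_mono_set hsubρ
      _ = ENNReal.ofReal (ν⁻¹ * (1 : ℝ) ^ Module.finrank ℝ (EuclideanSpace ℝ (Fin 3)))⁻¹ *
            ∫⁻ w in parabolicCylinder R ((T : ℝ), x₀), ‖uncurry q w‖ₑ ^ (3 / 2 : ℝ) :=
          setLIntegral_preimage_comp_stAffine hνi one_pos T x₀
            (fun w => ‖uncurry q w‖ₑ ^ (3 / 2 : ℝ)) _
      _ < ⊤ := by
          refine ENNReal.mul_lt_top ENNReal.ofReal_lt_top ?_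
          refine lt_of_le_of_lt (lintegral_mono_set (hQsub.trans ?_)) (hq32 (T + 1) hT1)
          exact prod_mono (Ioo_subset_Ioo_right (by linarith)) Subset.rfl
  · -- `W = ν⁻¹ (u ∘ Φ)` a.e. on the cylinder
    have h1 := ae_restrict_preimage_stAffine hνi one_pos T x₀
      (ae_restrict_of_ae_restrict_of_subset hQsub hae)
    filter_upwards [ae_restrict_of_ae_restrict_of_subset hsubρ h1] with w hw
    rw [uncurry_apply_pair, uncurry_apply_pair]
    change ν⁻¹ • v (T + ν⁻¹ * w.1) (x₀ + (1 : ℝ) • w.2) = ν⁻¹ • u (T + ν⁻¹ * w.1) (x₀ + (1 : ℝ) • w.2)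
    have : uncurry v (stAffine ν⁻¹ 1 T x₀ w) = uncurry u (stAffine ν⁻¹ 1 T x₀ w) := hw
    exact congrArg (ν⁻¹ • ·) this

/-! ### Step 2 — the Hölder representative of Seregin–Šverák and its identification with the classical solution -/

/-- **A smooth representative with uniform bounds, equal to the rescaled classical solution on the inner cylinder.**
[cite: SereginSverak2009, §2 p. 8] -/
theorem exists_holder_representative {ν T : ℝ} (hν : 0 < ν) (hT : 0 < T)
    {u : ℝ → EuclideanSpace ℝ (Fin 3) → EuclideanSpace ℝ (Fin 3)} {p : ℝ → EuclideanSpace ℝ (Fin 3) → ℝ}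
    (hsol : IsClassicalNSSolutionOn (Ico 0 T) ν 0 u p) (hLH : IsLerayHopfOn T ν 0 (u 0) u)
    (hdec : HasRapidSpatialDecay (u 0)) {x₀ : EuclideanSpace ℝ (Fin 3)}
    (hx₀ : ¬ IsBackwardSingularPoint u ((T : ℝ), x₀)) :
    ∃ (ρ : ℝ) (V : ℝ → EuclideanSpace ℝ (Fin 3) → EuclideanSpace ℝ (Fin 3)) (K C α : ℕ → ℝ → ℝ≥0),
      0 < ρ ∧ ρ ^ 2 / ν < T ∧ (∀ n : ℕ, ∀ r ∈ Ioo 0 ρ, 0 < α n r) ∧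
      (∀ w ∈ parabolicCylinder ρ ((0 : ℝ), (0 : EuclideanSpace ℝ (Fin 3))), ContDiffAt ℝ (⊤ : ℕ∞) (V w.1) w.2) ∧
      (∀ n : ℕ, ∀ r ∈ Ioo 0 ρ,
        HolderOnWith (C n r) (α n r)
          (fun w : ℝ × EuclideanSpace ℝ (Fin 3) => iteratedFDeriv ℝ n (V w.1) w.2)
          (parabolicCylinder r ((0 : ℝ), (0 : EuclideanSpace ℝ (Fin 3)))) ∧
        ∀ w ∈ parabolicCylinder r ((0 : ℝ), (0 : EuclideanSpace ℝ (Fin 3))),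
          ‖iteratedFDeriv ℝ n (V w.1) w.2‖ ≤ K n r) ∧
      EqOn (uncurry V) (uncurry (ν⁻¹ • stPull ν⁻¹ 1 T x₀ u))
        (parabolicCylinder (ρ / 2) ((0 : ℝ), (0 : EuclideanSpace ℝ (Fin 3)))) := by
  obtain ⟨ρ, M, W, P, hρ, hρT, hdist, hbd, hP, haeW⟩ :=
    exists_unit_distributional_on_cylinder hν hT hsol hLH hdec hx₀
  obtain ⟨K, C, α, hα, H⟩ := NSBoundedHigherRegularityBounds_holds ρ M
    ((∫⁻ w in parabolicCylinder ρ ((0 : ℝ), (0 : EuclideanSpace ℝ (Fin 3))), ‖P w.1 w.2‖ₑ ^ (3 / 2 : ℝ)).toNNReal)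
  obtain ⟨V, hVae, hVsmooth, hV⟩ :=
    H W P ((0 : ℝ), (0 : EuclideanSpace ℝ (Fin 3))) hdist hbd (ENNReal.coe_toNNReal hP.ne).symm.le
  refine ⟨ρ, V, K, C, α, hρ, hρT, hα, hVsmooth, hV, ?_⟩
  have hr₁ : ρ / 2 ∈ Ioo 0 ρ := ⟨by positivity, by linarith⟩
  have hsub₁ : parabolicCylinder (ρ / 2) ((0 : ℝ), (0 : EuclideanSpace ℝ (Fin 3))) ⊆
      parabolicCylinder ρ ((0 : ℝ), (0 : EuclideanSpace ℝ (Fin 3))) :=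
    parabolicCylinder_subset_of_le hr₁.1.le hr₁.2.le _
  -- `V` is continuous on `Q_{ρ/2}` (Hölder at order `0`)
  have hcontV : ContinuousOn (uncurry V) (parabolicCylinder (ρ / 2) ((0 : ℝ), (0 : EuclideanSpace ℝ (Fin 3)))) := by
    have h0 := ((hV 0 (ρ / 2) hr₁).1.continuousOn (hα 0 (ρ / 2) hr₁))
    have h1 := (continuousMultilinearCurryFin0 ℝ (EuclideanSpace ℝ (Fin 3))
      (EuclideanSpace ℝ (Fin 3))).continuous.comp_continuousOn h0
    refine h1.congr fun w _ => ?_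
    simp only [Function.comp_apply, continuousMultilinearCurryFin0_apply, iteratedFDeriv_zero_apply]
    rfl
  -- the rescaled classical solution is continuous on `Q_ρ` (its times stay in `(0, T)`)
  have hΦ : MapsTo (stAffine ν⁻¹ 1 T x₀) (parabolicCylinder ρ ((0 : ℝ), (0 : EuclideanSpace ℝ (Fin 3))))
      (Ico 0 T ×ˢ (univ : Set (EuclideanSpace ℝ (Fin 3)))) := by
    rintro ⟨s, y⟩ hw
    rw [mem_parabolicCylinder] at hw
    simp only at hw
    have hνi : 0 < ν⁻¹ := inv_pos.2 hν
    refine ⟨⟨?_, ?_⟩, mem_univ _⟩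
    · simp only [stAffine_apply]
      have hs : -ρ ^ 2 < s := by linarith [hw.1.1]
      have h1 : ν⁻¹ * (-ρ ^ 2) < ν⁻¹ * s := mul_lt_mul_of_pos_left hs hνi
      have h2 : ν⁻¹ * (-ρ ^ 2) = -(ρ ^ 2 / ν) := by field_simp
      linarith
    · simp only [stAffine_apply]
      have : ν⁻¹ * s < 0 := mul_neg_of_pos_of_neg hνi hw.1.2
      linarith
  have hcontW' : ContinuousOn (uncurry (ν⁻¹ • stPull ν⁻¹ 1 T x₀ u))
      (parabolicCylinder (ρ / 2) ((0 : ℝ), (0 : EuclideanSpace ℝ (Fin 3)))) := by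
    have hc : ContinuousOn (fun w : ℝ × EuclideanSpace ℝ (Fin 3) => ν⁻¹ • uncurry u (stAffine ν⁻¹ 1 T x₀ w))
        (parabolicCylinder ρ ((0 : ℝ), (0 : EuclideanSpace ℝ (Fin 3)))) :=
      (hsol.smooth_velocity.continuousOn.comp (continuous_stAffine ν⁻¹ 1 T x₀).continuousOn hΦ).const_smul ν⁻¹
    exact (hc.mono hsub₁).congr fun w _ => by rw [uncurry_apply_pair]; rfl
  exact NSBootstrap.eqOn_of_ae_eq_of_continuousOn (isOpen_parabolicCylinder _ _) hcontV hcontW'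
    (ae_restrict_of_ae_restrict_of_subset hsub₁ (hVae.symm.trans haeW))

end Summit.NavierStokesRegularity.NavierStokesRegularity.Theorems
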